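import Summits.Ventures.HSemireg.WedgeHankelRecurrenceGaussChristoffelDarbouxKernel

/-!
# Venture HSemireg — **DIAGONALISATION OF THE JACOBI MATRIX AND THE NEWTON SUMS OF THE GAUSS NODES**: for a positive recurrence with `q_{m+1} = ∏_k (X − z_k)`, the matrix `U = (q_j(z_k))_{j,k}`
# satisfies `J_m U = U diag(z)` (N293's eigenvectors as columns) and `U diag(λ) Uᵀ = diag(h_0, …, h_m)` with the Favard weights `λ_k > 0` and `h_j = b_1 ⋯ b_j` (N280's dual orthogonality in
# matrix form); hence `U` is invertible, `J_m = U diag(z) U⁻¹`, `J_m^p U = U diag(z)^p`, and **`tr J_m^p = Σ_k z_k^p` for every `p`** (all Newton sums of the Gauss nodes; `p = 1, 2` is N298)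

HONEST FRAMING. Part of the Lean index of the computation cell `pub-hsemireg` (seat p10 gen 43, Sunday typer «UNIFORM-IN-n»).  Square real matrices (products, transposes, inverses, traces,
determinants) and real polynomials only; no variety, no cohomology theory, no sheaf, no Ext group and no semiregularity map is constructed here; nothing here says that HC / HC_CM / HC_AV holds;
no Literature fact (unproved `Prop`) is declared or used.  Custodian versions as in `WedgeHankelSiegelIdeal` (1/3).
SOURCES (cited).  G. H. Golub, J. H. Welsch, *Calculation of Gauss quadrature rules*, Math. Comp. 23 (1969) 221–230, §2 (`J = Q Λ Qᵀ`, the nodes as eigenvalues, the weights from `Q`);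
W. Gautschi, *Orthogonal Polynomials: Computation and Approximation* (2004), Thm 1.31 and §3.1.1; T. S. Chihara, *An Introduction to Orthogonal Polynomials* (1978), Ch. I Thm 4.4 and (4.13)–(4.14)
(Newton sums of the zeros), Ch. IV §2; J. H. Wilkinson, *The Algebraic Eigenvalue Problem* (1965), Ch. 1 §§ 41–43 (similarity to a diagonal matrix, traces of powers).
PROOF TYPED HERE.  Columns: N293 `jacobi_eigenvector_of_eval_eq_zero`; `U diag(λ) Uᵀ = diag(h)` is N280 `favard_finite` read entrywise (its zeros re-identified by N294 `strictMono_eq_of_prod_X_sub_C_eq`),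
so `det U ≠ 0` from `det(U diag(λ) Uᵀ) = ∏ h_j > 0`; then `J^p U = U D^p` by induction and `tr J^p = tr(U D^p U⁻¹) = tr D^p` by `Matrix.trace_mul_comm`.
DEDUP DISCLOSURE (`rg -n 'eigenvectorMatrix|trace_jacobi_pow|jacobi_mul_eval_matrix|jacobi_eq_conj' Summits Literature`, 2026-09-03): N293 has the single eigenvectors and `χ(J) = q_{m+1}`; N298 the
traces of `J` and `J²` via coefficients; the matrix packaging and all higher Newton sums are new.  The 6 names below: 0 hits tree-wide.

WHAT IS IN THE TREE.  N280 `favard_finite`; N279 `recurrence_monic_natDegree`, `eq_prod_X_sub_C_of_monic_of_roots`; N293 `jacobi_eigenvector_of_eval_eq_zero`; N294 `strictMono_eq_of_prod_X_sub_C_eq`;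
Mathlib `Matrix.mul_apply`, `Matrix.mul_diagonal`, `Matrix.diagonal_mul_diagonal`, `Matrix.det_mul`, `Matrix.det_transpose`, `Matrix.det_diagonal`, `Matrix.mul_nonsing_inv`,
`Matrix.trace_mul_comm`, `Matrix.diagonal_pow`, `Matrix.trace_diagonal`.
THIS FILE (namespace `Summit.Ventures.HSemireg.Wedge.HankelOuter` continued; CHAINED on N299 (import), N280, N293, N294; 0 definitions — `U = Matrix.of fun j k => q_j(z_k)` inline):
* §1065 **`jacobi_mul_evalMatrix`** (`J_m U = U diag(z)`), **`evalMatrix_mul_weights_mul_transpose`** (`∃ λ > 0`: `U diag(λ) Uᵀ = diag(b_1⋯b_j)` — dual orthogonality in matrix form),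
  **`det_evalMatrix_ne_zero`**, `jacobi_pow_mul_evalMatrix` (`J_m^p U = U diag(z^p)`), **`jacobi_eq_conj_diagonal`** (`J_m = U diag(z) U⁻¹`), **`trace_jacobi_pow`** (GOLUB–WELSCH ∕ NEWTON:
  `tr J_m^p = Σ_k z_k^p` for all `p`).
CAVEATS.  Requires `b > 0` (so that `q_{m+1}` has `m + 1` distinct real zeros); `z` is any strictly increasing enumeration of them.  Nothing Ext-side.  New names only.
-/

open Module Polynomial
open scoped Matrix Polynomial

namespace Summit.Ventures.HSemireg.Wedge.HankelOuter

/-! ## §1065. `J_m = U diag(z) U⁻¹` with `U = (q_j(z_k))`; `tr J_m^p = Σ_k z_k^p` -/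

/-- **`J_m U = U diag(z)`** for `U_{jk} = q_j(z_k)`, `z_k` the zeros of `q_{m+1}` (the eigenvector identities of N293, column by column; no positivity needed). [Golub–Welsch 1969 §2; this file, §1065] -/
theorem jacobi_mul_evalMatrix {q : ℕ → ℝ[X]} {a b : ℕ → ℝ} (hq0 : q 0 = 1) (hq1 : q 1 = Polynomial.X - C (a 0))
    (hrec : ∀ n, q (n + 2) = (Polynomial.X - C (a (n + 1))) * q (n + 1) - C (b (n + 1)) * q n) {m : ℕ} {J : Matrix (Fin (m + 1)) (Fin (m + 1)) ℝ}
    (hJ : ∀ i j : Fin (m + 1), J i j = if (i : ℕ) = j then a i else if (j : ℕ) = i + 1 then 1 else if (i : ℕ) = j + 1 then b i else 0) {z : Fin (m + 1) → ℝ}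
    (hzr : ∀ k, (q (m + 1)).eval (z k) = 0) :
    J * Matrix.of (fun j k : Fin (m + 1) => (q j).eval (z k)) = Matrix.of (fun j k : Fin (m + 1) => (q j).eval (z k)) * Matrix.diagonal z := by
  ext i k
  have h := congr_fun (jacobi_eigenvector_of_eval_eq_zero hq0 hq1 hrec hJ (hzr k)).1 i
  simp only [Matrix.mulVec, dotProduct, Pi.smul_apply, smul_eq_mul] at h
  rw [Matrix.mul_apply, Matrix.mul_diagonal, Matrix.of_apply]
  simp only [Matrix.of_apply]
  rw [h, mul_comm]

/-- **Dual orthogonality in matrix form**: for a positive recurrence and `z_0 < ⋯ < z_m` the zeros of `q_{m+1}`, there are weights `λ_k > 0` with `U diag(λ) Uᵀ = diag(h)`, `h_j = b_1 ⋯ b_j`,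
`U_{jk} = q_j(z_k)`. [Favard 1935; Chihara I Thm 4.4 + (6.5); Golub–Welsch 1969 §2; this file, §1065] -/
theorem evalMatrix_mul_weights_mul_transpose {q : ℕ → ℝ[X]} {a b : ℕ → ℝ} (hq0 : q 0 = 1) (hq1 : q 1 = Polynomial.X - C (a 0))
    (hrec : ∀ n, q (n + 2) = (Polynomial.X - C (a (n + 1))) * q (n + 1) - C (b (n + 1)) * q n) (hb : ∀ j, 0 < b j) {m : ℕ} {z : Fin (m + 1) → ℝ}
    (hz : StrictMono z) (hzq : q (m + 1) = ∏ k, (Polynomial.X - C (z k))) :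
    ∃ μ : Fin (m + 1) → ℝ, (∀ k, 0 < μ k) ∧
      Matrix.of (fun j k : Fin (m + 1) => (q j).eval (z k)) * Matrix.diagonal μ * (Matrix.of (fun j k : Fin (m + 1) => (q j).eval (z k)))ᵀ =
        Matrix.diagonal (fun j : Fin (m + 1) => ∏ l ∈ Finset.Ico 1 ((j : ℕ) + 1), b l) := by
  obtain ⟨z', μ, hz', hz'r, hμ, -, hpair⟩ := favard_finite hq0 hq1 hrec hb m
  have hmd := recurrence_monic_natDegree hq0 hq1 hrec (m + 1)
  have hzz : z' = z := strictMono_eq_of_prod_X_sub_C_eq hz' hz ((eq_prod_X_sub_C_of_monic_of_roots hmd.1 hmd.2 hz'.injective hz'r).symm.trans hzq)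
  subst hzz
  refine ⟨μ, hμ, ?_⟩
  ext i j
  rw [Matrix.mul_apply, Matrix.diagonal_apply]
  simp only [Matrix.mul_diagonal, Matrix.of_apply, Matrix.transpose_apply]
  have hp := hpair i j
  have hrhs : (if i = j then ∏ l ∈ Finset.Ico 1 ((j : ℕ) + 1), b l else (0 : ℝ)) = if i = j then ∏ l ∈ Finset.Ico 1 ((i : ℕ) + 1), b l else 0 := by
    split_ifs with h
    · rw [h]
    · rfl
  rw [hrhs] at hp
  rw [← hp]
  exact Finset.sum_congr rfl fun k _ => by ring

/-- **`det U ≠ 0`** for `U_{jk} = q_j(z_k)` (positive recurrence, `z` the zeros of `q_{m+1}`). [Golub–Welsch 1969 §2; this file, §1065] -/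
theorem det_evalMatrix_ne_zero {q : ℕ → ℝ[X]} {a b : ℕ → ℝ} (hq0 : q 0 = 1) (hq1 : q 1 = Polynomial.X - C (a 0))
    (hrec : ∀ n, q (n + 2) = (Polynomial.X - C (a (n + 1))) * q (n + 1) - C (b (n + 1)) * q n) (hb : ∀ j, 0 < b j) {m : ℕ} {z : Fin (m + 1) → ℝ}
    (hz : StrictMono z) (hzq : q (m + 1) = ∏ k, (Polynomial.X - C (z k))) :
    (Matrix.of (fun j k : Fin (m + 1) => (q j).eval (z k))).det ≠ 0 := by
  obtain ⟨μ, -, hU⟩ := evalMatrix_mul_weights_mul_transpose hq0 hq1 hrec hb hz hzq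
  have hdet := congrArg Matrix.det hU
  rw [Matrix.det_mul, Matrix.det_mul, Matrix.det_transpose, Matrix.det_diagonal, Matrix.det_diagonal] at hdet
  intro h0
  rw [h0, zero_mul, zero_mul] at hdet
  exact (Finset.prod_pos fun j _ => Finset.prod_pos fun l _ => hb l).ne' hdet.symm

/-- **`J_m^p U = U diag(z_k^p)`** for every `p`. [Wilkinson Ch. 1 §41; this file, §1065] -/
theorem jacobi_pow_mul_evalMatrix {q : ℕ → ℝ[X]} {a b : ℕ → ℝ} (hq0 : q 0 = 1) (hq1 : q 1 = Polynomial.X - C (a 0))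
    (hrec : ∀ n, q (n + 2) = (Polynomial.X - C (a (n + 1))) * q (n + 1) - C (b (n + 1)) * q n) {m : ℕ} {J : Matrix (Fin (m + 1)) (Fin (m + 1)) ℝ}
    (hJ : ∀ i j : Fin (m + 1), J i j = if (i : ℕ) = j then a i else if (j : ℕ) = i + 1 then 1 else if (i : ℕ) = j + 1 then b i else 0) {z : Fin (m + 1) → ℝ}
    (hzr : ∀ k, (q (m + 1)).eval (z k) = 0) (p : ℕ) :
    J ^ p * Matrix.of (fun j k : Fin (m + 1) => (q j).eval (z k)) = Matrix.of (fun j k : Fin (m + 1) => (q j).eval (z k)) * Matrix.diagonal (fun k => z k ^ p) := by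
  induction p with
  | zero => simp
  | succ p ih =>
    rw [pow_succ, Matrix.mul_assoc, jacobi_mul_evalMatrix hq0 hq1 hrec hJ hzr, ← Matrix.mul_assoc, ih, Matrix.mul_assoc, Matrix.diagonal_mul_diagonal]
    simp only [pow_succ]

/-- **`J_m = U diag(z) U⁻¹`** (similarity to the diagonal matrix of the Gauss nodes). [Golub–Welsch 1969 §2; Gautschi Thm 1.31; this file, §1065] -/
theorem jacobi_eq_conj_diagonal {q : ℕ → ℝ[X]} {a b : ℕ → ℝ} (hq0 : q 0 = 1) (hq1 : q 1 = Polynomial.X - C (a 0))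
    (hrec : ∀ n, q (n + 2) = (Polynomial.X - C (a (n + 1))) * q (n + 1) - C (b (n + 1)) * q n) (hb : ∀ j, 0 < b j) {m : ℕ} {J : Matrix (Fin (m + 1)) (Fin (m + 1)) ℝ}
    (hJ : ∀ i j : Fin (m + 1), J i j = if (i : ℕ) = j then a i else if (j : ℕ) = i + 1 then 1 else if (i : ℕ) = j + 1 then b i else 0) {z : Fin (m + 1) → ℝ}
    (hz : StrictMono z) (hzq : q (m + 1) = ∏ k, (Polynomial.X - C (z k))) :
    J = Matrix.of (fun j k : Fin (m + 1) => (q j).eval (z k)) * Matrix.diagonal z * (Matrix.of (fun j k : Fin (m + 1) => (q j).eval (z k)))⁻¹ := by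
  have hzr : ∀ k, (q (m + 1)).eval (z k) = 0 := fun k => by
    rw [hzq, eval_prod]; exact Finset.prod_eq_zero (Finset.mem_univ k) (by simp)
  have hdet : IsUnit (Matrix.of (fun j k : Fin (m + 1) => (q j).eval (z k))).det := isUnit_iff_ne_zero.2 (det_evalMatrix_ne_zero hq0 hq1 hrec hb hz hzq)
  rw [← jacobi_mul_evalMatrix hq0 hq1 hrec hJ hzr, Matrix.mul_assoc, Matrix.mul_nonsing_inv _ hdet, Matrix.mul_one]

/-- **GOLUB–WELSCH ∕ NEWTON: `tr J_m^p = Σ_k z_k^p` for every `p`** — all power sums of the Gauss nodes are traces of powers of the Jacobi matrix. [Golub–Welsch 1969 §2; Chihara I (4.13)–(4.14);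
Wilkinson Ch. 1 §43; this file, §1065] -/
theorem trace_jacobi_pow {q : ℕ → ℝ[X]} {a b : ℕ → ℝ} (hq0 : q 0 = 1) (hq1 : q 1 = Polynomial.X - C (a 0))
    (hrec : ∀ n, q (n + 2) = (Polynomial.X - C (a (n + 1))) * q (n + 1) - C (b (n + 1)) * q n) (hb : ∀ j, 0 < b j) {m : ℕ} {J : Matrix (Fin (m + 1)) (Fin (m + 1)) ℝ}
    (hJ : ∀ i j : Fin (m + 1), J i j = if (i : ℕ) = j then a i else if (j : ℕ) = i + 1 then 1 else if (i : ℕ) = j + 1 then b i else 0) {z : Fin (m + 1) → ℝ}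
    (hz : StrictMono z) (hzq : q (m + 1) = ∏ k, (Polynomial.X - C (z k))) (p : ℕ) :
    (J ^ p).trace = ∑ k, z k ^ p := by
  set U : Matrix (Fin (m + 1)) (Fin (m + 1)) ℝ := Matrix.of (fun j k : Fin (m + 1) => (q j).eval (z k)) with hU
  have hzr : ∀ k, (q (m + 1)).eval (z k) = 0 := fun k => by
    rw [hzq, eval_prod]; exact Finset.prod_eq_zero (Finset.mem_univ k) (by simp)
  have hdet : IsUnit U.det := isUnit_iff_ne_zero.2 (det_evalMatrix_ne_zero hq0 hq1 hrec hb hz hzq)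
  have hpow := jacobi_pow_mul_evalMatrix hq0 hq1 hrec hJ hzr p
  calc (J ^ p).trace = (J ^ p * U * U⁻¹).trace := by rw [Matrix.mul_assoc, Matrix.mul_nonsing_inv _ hdet, Matrix.mul_one]
    _ = (U * Matrix.diagonal (fun k => z k ^ p) * U⁻¹).trace := by rw [hpow]
    _ = (U⁻¹ * (U * Matrix.diagonal (fun k => z k ^ p))).trace := Matrix.trace_mul_comm _ _
    _ = (Matrix.diagonal (fun k => z k ^ p)).trace := by rw [← Matrix.mul_assoc, Matrix.nonsing_inv_mul _ hdet, Matrix.one_mul]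
    _ = ∑ k, z k ^ p := Matrix.trace_diagonal _

end Summit.Ventures.HSemireg.Wedge.HankelOuter
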